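import Summits.KontsevichZagierPeriods.KontsevichZagierPeriods.Theorems.HurwitzMicroSectorsNormalFormPrincipleDlogMoves
import Summits.KontsevichZagierPeriods.KontsevichZagierPeriods.Theorems.HurwitzMicroSectorsNormalFormPrincipleSplitMoves

/-!
# `NormalFormPrinciple` (stmt-KontsevichZagierPeriods-3869), registered sub-goal `nf_pole_one`:
# a simple rational pole off `[0,1]` in the normal form "rational point + prime carriers"

Pure proof file (siege k18, explicit / elementary route; `--supports` the crux). For `ρ ∈ ℚ ∖ [0,1]`,
`c ∈ ℚ` and `T = [(0,1), c/(x − ρ)]`,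

  `[T] = [pt, 0] + Σ_{p ∈ S} [(1,p), C_p / y]`  in `FormalRep ⧸ relations`,

with `S` a finite set of primes and `C_p ∈ ℚ` (`nf_pole_one`). The proof is the explicit one, by
the moves of `…NormalFormPrincipleDlogMoves.lean` / `…SplitMoves.lean` only:

1. ONE affine move (rule 2), `y = x − ρ` if `ρ < 0` and `y = ρ − x` if `ρ > 1`, turns `T` into a
   dlog representation `[(a,b), c'/y]` with rational ends `0 < a < b`
   (`exists_pole_sub_slab_mem_relations`, via `affine_sub_mem_relations` of `…SplitMoves.lean`);
2. ONE scaling move (rule 2) by a common denominator makes the ends natural numbers `1 ≤ A ≤ B`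
   (`exists_common_scaling`, `mk_slab_eq_mk_slab_smul`), and ONE splitting move (rule 1a) gives
   `[(A,B), c'/y] = Λ(B) − Λ(A)` for the carriers `Λ(N) = [(1,N), c'/y]` (`mk_slab_nat_eq_sub`);
3. `Λ(MN) = Λ(M) + Λ(N)` (split `[(1,MN)]` at `M`, rescale `[(1,N)]` to `[(M,MN)]`;
   `mk_carrier_mul`), hence, by unique factorisation, `Λ(N) = Σ_p v_p(N) • Λ(p)`
   (`mk_carrier_eq_sum_factorization`);
4. merging (rule 1b) moves integer multiples into the coefficient, `n • [(1,p), c/y] =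
   [(1,p), n c/y]` and `[(1,p), (c − c')/y] = [(1,p), c/y] − [(1,p), c'/y]`
   (`nsmul_mk_carrier`, `mk_carrier_sub`).

So `C_p = (v_p(B) − v_p(A)) · c'` on `S = primeFactors A ∪ primeFactors B`, and the rational
point carries `0` (`[pt, 0] ∈ relations`). Value check: `Σ_p C_p log p = c' log (B/A) =
c' log (b/a) = c log |(ρ − 1)/ρ| = ∫₀¹ c dx/(x − ρ)`.

Sources: M. Kontsevich, D. Zagier, *Periods* (2001), §1.1 (`log 2 = ∫₁² dx/x`), §1.2 rules (1),
(2). No definitions are introduced.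
-/

noncomputable section

open MeasureTheory Set Finset
open Literature.NumberTheory.Transcendental Literature.NumberTheory.Transcendental.KZ

namespace Summit.KontsevichZagierPeriods.HurwitzMicroSectors.NormalFormPrinciple.PiBox.Dlog.PoleOneK18

/-! ## Bookkeeping in the quotient `FormalRep ⧸ relations` -/

/-- `x − y ∈ relations` gives `[x] = [y]` in `FormalRep ⧸ relations`. [folklore] -/
private theorem mk_eq_of_sub_mem {x y : FormalRep} (h : x - y ∈ relations) :
    QuotientAddGroup.mk' relations x = QuotientAddGroup.mk' relations y := by
  rw [QuotientAddGroup.mk'_apply, QuotientAddGroup.mk'_apply, QuotientAddGroup.eq_iff_sub_mem]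
  exact h

/-- `x − y − z ∈ relations` gives `[x] = [y] + [z]` in `FormalRep ⧸ relations`. [folklore] -/
private theorem mk_eq_add_of_sub_sub_mem {x y z : FormalRep} (h : x - y - z ∈ relations) :
    QuotientAddGroup.mk' relations x =
      QuotientAddGroup.mk' relations y + QuotientAddGroup.mk' relations z := by
  rw [← map_add, QuotientAddGroup.mk'_apply, QuotientAddGroup.mk'_apply,
    QuotientAddGroup.eq_iff_sub_mem, sub_add_eq_sub_sub]
  exact h

/-- `x ∈ relations` gives `[x] = 0` in `FormalRep ⧸ relations`. [folklore] -/
private theorem mk_eq_zero_of_mem {x : FormalRep} (h : x ∈ relations) :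
    QuotientAddGroup.mk' relations x = 0 := by
  rw [QuotientAddGroup.mk'_apply, QuotientAddGroup.eq_zero_iff]
  exact h

/-! ## Carriers `Λ(N, c) = [(1,N), c/y]` and their arithmetic -/

section Carriers

variable {R : ℚ → ℚ → ℚ → IntegralRep 1}
  (hR : ∀ a b c, 0 < a → (R a b c).domain = {x | x 0 ∈ Set.Ioo (a:ℝ) b} ∧
    (R a b c).integrand = fun x => (c:ℝ) / x 0)
include hR

/-- The empty carrier `[(1,1), c/y]` is a relation (null domain).
[cite: KontsevichZagier2001, §1.2 rule (1)] -/
theorem carrier_one_mem_relations (c : ℚ) : of (R 1 1 c) ∈ relations :=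
  slab_empty_mem_relations (R 1 1 c) (hR 1 1 c one_pos).1 le_rfl

/-- **Scaling move** in the quotient: `[(a,b), c/y] = [(sa,sb), c/y]` for rational `s > 0`,
`a > 0`. [cite: KontsevichZagier2001, §1.2 rule (2)] -/
theorem mk_slab_eq_mk_slab_smul {a b c s : ℚ} (ha : 0 < a) (hs : 0 < s) :
    QuotientAddGroup.mk' relations (of (R a b c)) =
      QuotientAddGroup.mk' relations (of (R (s * a) (s * b) c)) :=
  mk_eq_of_sub_mem (dlog_scale_mem_relations (R a b c) (R (s * a) (s * b) c) (hR a b c ha).1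
    (hR _ _ c (mul_pos hs ha)).1 (by rw [(hR a b c ha).2]; exact fun _ _ => rfl)
    (by rw [(hR _ _ c (mul_pos hs ha)).2]; exact fun _ _ => rfl) ha hs)

/-- **Splitting move** in the quotient, at natural ends `1 ≤ A ≤ B`:
`[(A,B), c/y] = Λ(B, c) − Λ(A, c)`. [cite: KontsevichZagier2001, §1.2 rule (1)] -/
theorem mk_slab_nat_eq_sub {c : ℚ} {A B : ℕ} (hA : 1 ≤ A) (hAB : A ≤ B) :
    QuotientAddGroup.mk' relations (of (R A B c)) =
      QuotientAddGroup.mk' relations (of (R 1 B c)) -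
        QuotientAddGroup.mk' relations (of (R 1 A c)) := by
  have hA0 : (0:ℚ) < A := by exact_mod_cast hA
  have h := split_mem_relations (R 1 B c) (R 1 A c) (R A B c) (hR 1 B c one_pos).1
    (hR 1 A c one_pos).1 (hR A B c hA0).1 (by exact_mod_cast hA) (by exact_mod_cast hAB)
    (by rw [(hR 1 (A:ℚ) c one_pos).2, (hR 1 (B:ℚ) c one_pos).2]; exact fun _ _ => rfl)
    (by rw [(hR (A:ℚ) (B:ℚ) c hA0).2, (hR 1 (B:ℚ) c one_pos).2]; exact fun _ _ => rfl)
  rw [mk_eq_add_of_sub_sub_mem h]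
  abel

/-- **Multiplicativity of the carriers**: `Λ(MN, c) = Λ(M, c) + Λ(N, c)` for `M, N ≥ 1` — split
`[(1,MN)]` at `M` (rule 1a) and rescale `[(1,N)]` to `[(M,MN)]` (rule 2).
[cite: KontsevichZagier2001, §1.2 rules (1), (2)] -/
theorem mk_carrier_mul {c : ℚ} {M N : ℕ} (hM : 1 ≤ M) (hN : 1 ≤ N) :
    QuotientAddGroup.mk' relations (of (R 1 ((M:ℚ) * N) c)) =
      QuotientAddGroup.mk' relations (of (R 1 M c)) +
        QuotientAddGroup.mk' relations (of (R 1 N c)) := by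
  have hM0 : (0:ℚ) < M := by exact_mod_cast hM
  have hMN : ((M:ℚ):ℝ) ≤ (((M:ℚ) * N : ℚ):ℝ) := by
    have : (M:ℝ) ≤ (M:ℝ) * N := by exact_mod_cast Nat.le_mul_of_pos_right M hN
    push_cast
    exact this
  -- split `[(1, MN)]` at `M`
  have h1 := split_mem_relations (R 1 ((M:ℚ) * N) c) (R 1 M c) (R M ((M:ℚ) * N) c)
    (hR 1 _ c one_pos).1 (hR 1 (M:ℚ) c one_pos).1 (hR (M:ℚ) _ c hM0).1 (by exact_mod_cast hM) hMN
    (by rw [(hR 1 (M:ℚ) c one_pos).2, (hR 1 ((M:ℚ) * N) c one_pos).2]; exact fun _ _ => rfl)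
    (by rw [(hR (M:ℚ) ((M:ℚ) * N) c hM0).2, (hR 1 ((M:ℚ) * N) c one_pos).2];
        exact fun _ _ => rfl)
  -- rescale `[(1,N)]` to `[(M, MN)]`
  have h2 := dlog_scale_mem_relations (s := (M:ℚ)) (R 1 N c) (R M ((M:ℚ) * N) c)
    (hR 1 (N:ℚ) c one_pos).1 (by rw [mul_one]; exact (hR (M:ℚ) ((M:ℚ) * N) c hM0).1)
    (by rw [(hR 1 (N:ℚ) c one_pos).2]; exact fun _ _ => rfl)
    (by rw [(hR (M:ℚ) ((M:ℚ) * N) c hM0).2]; exact fun _ _ => rfl) one_pos hM0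
  rw [mk_eq_add_of_sub_sub_mem h1, mk_eq_of_sub_mem h2]

/-- **Unique factorisation of the carriers**: `Λ(N, c) = Σ_p v_p(N) • Λ(p, c)` for `N ≠ 0`.
[cite: KontsevichZagier2001, §1.1] -/
theorem mk_carrier_eq_sum_factorization {c : ℚ} {N : ℕ} (hN : N ≠ 0) :
    QuotientAddGroup.mk' relations (of (R 1 N c)) =
      N.factorization.sum fun p k => k • QuotientAddGroup.mk' relations (of (R 1 p c)) := by
  induction N using Nat.recOnMul with
  | zero => exact absurd rfl hN
  | one =>
    rw [Nat.factorization_one, Finsupp.sum_zero_index, Nat.cast_one]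
    exact mk_eq_zero_of_mem (carrier_one_mem_relations hR c)
  | prime p hp =>
    rw [hp.factorization, Finsupp.sum_single_index]
    · rw [one_nsmul]
    · exact zero_nsmul _
  | mul a b iha ihb =>
    obtain ⟨ha, hb⟩ := mul_ne_zero_iff.mp hN
    rw [Nat.factorization_mul ha hb,
      Finsupp.sum_add_index'
        (h := fun (p k : ℕ) => k • QuotientAddGroup.mk' relations (of (R 1 p c)))
        (fun _ => zero_nsmul _) (fun _ _ _ => add_nsmul _ _ _), ← iha ha, ← ihb hb, Nat.cast_mul]
    exact mk_carrier_mul hR (Nat.one_le_iff_ne_zero.mpr ha) (Nat.one_le_iff_ne_zero.mpr hb)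

/-- **Merging**: `Λ(q, c − c') = Λ(q, c) − Λ(q, c')`. [cite: KontsevichZagier2001, §1.2 rule (1)] -/
theorem mk_carrier_sub (q c c' : ℚ) :
    QuotientAddGroup.mk' relations (of (R 1 q (c - c'))) =
      QuotientAddGroup.mk' relations (of (R 1 q c)) -
        QuotientAddGroup.mk' relations (of (R 1 q c')) := by
  have h := dlog_merge_mem_relations (c := c - c') (c' := c') (R 1 q c) (R 1 q (c - c')) (R 1 q c')
    (hR 1 q c one_pos).1 (hR 1 q _ one_pos).1 (hR 1 q c' one_pos).1
    (by rw [(hR 1 q c one_pos).2, sub_add_cancel]; exact fun _ _ => rfl)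
    (by rw [(hR 1 q _ one_pos).2]; exact fun _ _ => rfl)
    (by rw [(hR 1 q c' one_pos).2]; exact fun _ _ => rfl)
  rw [mk_eq_add_of_sub_sub_mem h]
  abel

/-- **Merging of multiples**: `n • Λ(q, c) = Λ(q, n c)`. [cite: KontsevichZagier2001, §1.2 rule (1)] -/
theorem nsmul_mk_carrier (q c : ℚ) (n : ℕ) :
    n • QuotientAddGroup.mk' relations (of (R 1 q c)) =
      QuotientAddGroup.mk' relations (of (R 1 q (n * c))) := by
  induction n with
  | zero =>
    rw [zero_nsmul]
    refine (mk_eq_zero_of_mem (dlog_zero_mem_relations _ fun x _ => ?_)).symm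
    rw [(hR 1 q _ one_pos).2]
    simp
  | succ n ih =>
    have key : (((n + 1 : ℕ) : ℚ) * c) = n * c + c := by push_cast; ring
    have h := mk_carrier_sub hR q (n * c + c) c
    rw [add_sub_cancel_right] at h
    rw [succ_nsmul, ih, key, h, sub_add_cancel]

end Carriers

/-! ## Clearing denominators -/

/-- Two positive rationals have a common positive denominator: `D a, D b ∈ ℕ`. [folklore] -/
theorem exists_common_scaling {a b : ℚ} (ha : 0 < a) (hb : 0 < b) :
    ∃ D A B : ℕ, 0 < D ∧ (D:ℚ) * a = A ∧ (D:ℚ) * b = B := by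
  refine ⟨a.den * b.den, a.num.toNat * b.den, b.num.toNat * a.den,
    Nat.mul_pos a.den_pos b.den_pos, ?_, ?_⟩
  · have h1 : ((a.num.toNat : ℤ)) = a.num := Int.toNat_of_nonneg (Rat.num_pos.mpr ha).le
    have h2 : a * a.den = a.num := Rat.mul_den_eq_num a
    have h3 : ((a.num.toNat : ℕ) : ℚ) = (a.num : ℚ) := by exact_mod_cast h1
    calc ((a.den * b.den : ℕ) : ℚ) * a = (a * a.den) * b.den := by push_cast; ring
      _ = ((a.num.toNat : ℕ) : ℚ) * b.den := by rw [h2, h3]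
      _ = ((a.num.toNat * b.den : ℕ) : ℚ) := by push_cast; ring
  · have h1 : ((b.num.toNat : ℤ)) = b.num := Int.toNat_of_nonneg (Rat.num_pos.mpr hb).le
    have h2 : b * b.den = b.num := Rat.mul_den_eq_num b
    have h3 : ((b.num.toNat : ℕ) : ℚ) = (b.num : ℚ) := by exact_mod_cast h1
    calc ((a.den * b.den : ℕ) : ℚ) * b = (b * b.den) * a.den := by push_cast; ring
      _ = ((b.num.toNat : ℕ) : ℚ) * a.den := by rw [h2, h3]
      _ = ((b.num.toNat * a.den : ℕ) : ℚ) := by push_cast; ring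

/-! ## The affine move: a simple pole off `[0,1]` is a dlog slab -/

/-- **The pole as a dlog slab** (one rule-(2) move): for `ρ ∈ ℚ ∖ [0,1]`,
`[(0,1), c/(x − ρ)] − [(a,b), c'/y] ∈ relations` for some rationals `0 < a < b`, `c'` — namely
`y = x − ρ`, `(a,b) = (−ρ, 1−ρ)`, `c' = c` if `ρ < 0`, and `y = ρ − x`, `(a,b) = (ρ−1, ρ)`, `c' = −c`
if `ρ > 1` (the affine moves of `…SplitMoves.lean`). [cite: KontsevichZagier2001, §1.2 rule (2)] -/
theorem exists_pole_sub_slab_mem_relations {R : ℚ → ℚ → ℚ → IntegralRep 1}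
    (hR : ∀ a b c, 0 < a → (R a b c).domain = {x | x 0 ∈ Set.Ioo (a:ℝ) b} ∧
      (R a b c).integrand = fun x => (c:ℝ) / x 0)
    {c ρ : ℚ} (hρ : (ρ:ℝ) ∉ Set.Icc (0:ℝ) 1) (T : IntegralRep 1)
    (hTd : T.domain = {x | x 0 ∈ Set.Ioo (0:ℝ) 1})
    (hTi : EqOn T.integrand (fun x => (c:ℝ) / (x 0 - ρ)) T.domain) :
    ∃ a b c' : ℚ, 0 < a ∧ a < b ∧ of T - of (R a b c') ∈ relations := by
  have hρ' : ρ < 0 ∨ 1 < ρ := by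
    rcases lt_or_ge ρ 0 with h | h
    · exact Or.inl h
    · refine Or.inr (not_le.mp fun h1 => hρ (Set.mem_Icc.mpr ⟨?_, ?_⟩))
      · exact_mod_cast h
      · exact_mod_cast h1
  rcases hρ' with hneg | hbig
  · -- `y = x − ρ` maps `(0,1)` onto `(−ρ, 1−ρ)`; `c/(x−ρ) = c/y · |1|`
    have ha : (0:ℚ) < -ρ := by linarith
    refine ⟨-ρ, 1 - ρ, c, ha, by linarith, ?_⟩
    refine affine_sub_mem_relations (s := 1) (t := -ρ) one_ne_zero T (R (-ρ) (1 - ρ) c)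
      (fun y => (c:ℝ) / y) ?_ ?_ ?_
    · rw [(hR _ _ c ha).1, hTd, Rat.cast_one, image_affine_slab_of_pos one_pos]
      ext x
      simp only [Set.mem_setOf_eq, Set.mem_Ioo]
      push_cast
      constructor <;> rintro ⟨h1, h2⟩ <;> constructor <;> linarith
    · rw [(hR _ _ c ha).2]
      exact fun _ _ => rfl
    · intro x hx
      rw [hTi hx]
      simp [sub_eq_add_neg]
  · -- `y = ρ − x` maps `(0,1)` onto `(ρ−1, ρ)`; `c/(x−ρ) = (−c)/y · |−1|`
    have ha : (0:ℚ) < ρ - 1 := by linarith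
    refine ⟨ρ - 1, ρ, -c, ha, by linarith, ?_⟩
    refine affine_sub_mem_relations (s := -1) (t := ρ) (by norm_num) T (R (ρ - 1) ρ (-c))
      (fun y => ((-c : ℚ):ℝ) / y) ?_ ?_ ?_
    · rw [(hR _ _ _ ha).1, hTd, Rat.cast_neg, Rat.cast_one,
        image_affine_slab_of_neg (by norm_num : (-1:ℝ) < 0)]
      ext x
      simp only [Set.mem_setOf_eq, Set.mem_Ioo]
      push_cast
      constructor <;> rintro ⟨h1, h2⟩ <;> constructor <;> linarith
    · rw [(hR _ _ _ ha).2]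
      exact fun _ _ => rfl
    · intro x hx
      have hx1 : x 0 < 1 := by rw [hTd] at hx; exact hx.2
      have hρ1 : (1:ℝ) < ρ := by exact_mod_cast hbig
      have hne : x 0 - ρ ≠ 0 := by
        intro h; linarith
      have hne' : (-1:ℝ) * x 0 + ρ ≠ 0 := by
        intro h; linarith
      rw [hTi hx]
      simp only [Rat.cast_neg, Rat.cast_one, abs_neg, abs_one, mul_one]
      rw [div_eq_div_iff hne hne']
      ring

/-! ## The registered sub-goal -/

/-- **Registered sub-goal `nf_pole_one`** of crux stmt-KontsevichZagierPeriods-3869 (line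
`SketchIdeator1`, split-denominator layer of the leaf `stub_boxRigidity`): a simple rational pole
`[(0,1), c/(x − ρ)]`, `ρ ∈ ℚ ∖ [0,1]`, is in the normal form "rational point + prime carriers"
modulo `KZ.relations`: `[T] = [pt, r] + Σ_{p ∈ S} [(1,p), C_p/y]` with `S` a finite set of primes,
`C_p ∈ ℚ` vanishing off `S` (here `r = 0`, `S = primeFactors A ∪ primeFactors B`,
`C_p = (v_p(B) − v_p(A)) c'` for the cleared ends `A ≤ B` of the dlog slab of the pole). Explicit:
one affine move, one scaling, splittings and mergings; unique factorisation is the only arithmetic.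
[cite: KontsevichZagier2001, §1.1, §1.2 rules (1), (2)] -/
theorem nf_pole_one {R : ℚ → ℚ → ℚ → IntegralRep 1} {Z : ℚ → IntegralRep 0}
    (hR : ∀ a b c, 0 < a → (R a b c).domain = {x | x 0 ∈ Set.Ioo (a:ℝ) b} ∧
      (R a b c).integrand = fun x => (c:ℝ) / x 0)
    (hZ : ∀ r, (Z r).domain = univ ∧ (Z r).integrand = fun _ => (r:ℝ)) {c ρ : ℚ}
    (hρ : (ρ:ℝ) ∉ Set.Icc (0:ℝ) 1) (T : IntegralRep 1)
    (hTd : T.domain = {x | x 0 ∈ Set.Ioo (0:ℝ) 1})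
    (hTi : EqOn T.integrand (fun x => (c:ℝ) / (x 0 - ρ)) T.domain) :
    ∃ (r : ℚ) (S : Finset ℕ) (C : ℕ → ℚ), (∀ p ∈ S, p.Prime) ∧ (∀ p, p ∉ S → C p = 0) ∧
      QuotientAddGroup.mk' relations (of T) = QuotientAddGroup.mk' relations (of (Z r)) +
        ∑ p ∈ S, QuotientAddGroup.mk' relations (of (R 1 p (C p))) := by
  -- Step 1: the pole is a dlog slab `[(a,b), c'/y]`, `0 < a < b` rational.
  obtain ⟨a, b, c', ha, hab, hT⟩ := exists_pole_sub_slab_mem_relations hR hρ T hTd hTi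
  replace hT := mk_eq_of_sub_mem hT
  -- Step 2: clear denominators, `D a = A`, `D b = B`, `1 ≤ A ≤ B`.
  obtain ⟨D, A, B, hD, hA, hB⟩ := exists_common_scaling ha (ha.trans hab)
  have hD' : (0:ℚ) < D := by exact_mod_cast hD
  have hA1 : 1 ≤ A := by
    have : (0:ℚ) < A := by rw [← hA]; exact mul_pos hD' ha
    exact_mod_cast this
  have hAB : A ≤ B := by
    have : (A:ℚ) ≤ B := by
      rw [← hA, ← hB]; exact mul_le_mul_of_nonneg_left hab.le hD'.le
    exact_mod_cast this
  have hA0 : A ≠ 0 := by omega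
  have hB0 : B ≠ 0 := by omega
  have hsubA : A.factorization.support ⊆ A.primeFactors ∪ B.primeFactors := by
    rw [Nat.support_factorization]; exact Finset.subset_union_left
  have hsubB : B.factorization.support ⊆ A.primeFactors ∪ B.primeFactors := by
    rw [Nat.support_factorization]; exact Finset.subset_union_right
  -- `[pt, 0]` is a relation
  have hZ0 : QuotientAddGroup.mk' relations (of (Z 0)) = 0 :=
    mk_eq_zero_of_mem (of_mem_relations_of_eqOn_zero _ fun x _ => by simp [(hZ 0).2])
  refine ⟨0, A.primeFactors ∪ B.primeFactors,
    fun p => ((B.factorization p : ℚ) - (A.factorization p : ℚ)) * c', ?_, ?_, ?_⟩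
  · intro p hp
    rcases Finset.mem_union.mp hp with h | h <;> exact Nat.prime_of_mem_primeFactors h
  · intro p hp
    rw [Finset.mem_union, not_or, ← Nat.support_factorization, ← Nat.support_factorization,
      Finsupp.notMem_support_iff, Finsupp.notMem_support_iff] at hp
    simp [hp.1, hp.2]
  · rw [hZ0, zero_add, hT, mk_slab_eq_mk_slab_smul hR ha hD', hA, hB, mk_slab_nat_eq_sub hR hA1 hAB,
      mk_carrier_eq_sum_factorization hR hB0, mk_carrier_eq_sum_factorization hR hA0,
      Finsupp.sum_of_support_subset _ hsubB
        (fun (p k : ℕ) => k • QuotientAddGroup.mk' relations (of (R 1 p c'))) (fun _ _ => zero_nsmul _),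
      Finsupp.sum_of_support_subset _ hsubA
        (fun (p k : ℕ) => k • QuotientAddGroup.mk' relations (of (R 1 p c'))) (fun _ _ => zero_nsmul _),
      ← Finset.sum_sub_distrib]
    refine Finset.sum_congr rfl fun p _ => ?_
    rw [nsmul_mk_carrier hR, nsmul_mk_carrier hR]
    simp only [sub_mul]
    exact (mk_carrier_sub hR _ _ _).symm

end Summit.KontsevichZagierPeriods.HurwitzMicroSectors.NormalFormPrinciple.PiBox.Dlog.PoleOneK18
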